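import Summits.ValiantsHypothesis.ValiantsHypothesis.Theorems.TwoProducts.RankThreeAffineUnitLadder
import Literature.LinearAlgebra.Matrix.WronskianDerivation

/-!
# Toric Wronskians: ONE RESONANCE CLASS of any size is tame (the first resonant case of (TW-count) in kernel)

Context ((COL)/(COL-2), ✓ p710727 / `…RankThreeAffineOLMColumnsResidue`; residue of record of the OLM slot, val-idea-crit-8 g5 #91/#92): the ψ-free
residue term (TW-count) asks for a polynomial bound on the edge directions of the iterated toric brackets of the u-free monomials — flag toric
WRONSKIANS `W_D(X^{e_0},…,X^{e_j})` for the derivation `D = J(·,u)` (✓ `jacDer u`).  On a NON-resonant arc their top is a Vandermonde monomial (no edge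
direction); this file proves the FIRST RESONANT configuration exactly: all columns on ONE line `e + ℕ·q` («one resonance class»; the interesting case is
`q ∥` a pivot of `u`, where the Vandermonde top vanishes).
★★ `toricW_wronskian_ray`:  `W_{J(·,u)}(X^{e+n_1 q},…,X^{e+n_r q}) = ε_q^{C(r,2)} · Π_{i<j}(n_j − n_i) · X^{Σ_j (e+n_j q)}`  EXACTLY, for ALL `u, e, q, n`,
where `ε_q := rayEps u q = Σ_{s∈supp u} det(q,s)·u_s·X^s` (so `J(X^q,u) = X^q·ε_q`; support ⊆ `S1 u`).  Mechanism (the pattern of ✓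
`Literature.LinearAlgebra.Matrix.wronskian_smul`, Zannier's change of derivation): `D^[a](X^{e+nq}) = X^{e+nq}·Σ_c M_{a,c}·n^c` with a LOWER-TRIANGULAR
coefficient table `M` (`M_{a,a} = ε_q^a`; `toricW_iterate_eq`), so the Wronskian matrix factors as `M · (Vandermondeᵀ · diag)` and ✓ `Matrix.det_of_lowerTriangular`,
✓ `Matrix.det_vandermonde` finish.
★ `toricW_Eset_ray_subset`: hence `Eset σ (that Wronskian) ⊆ Xc σ u` (`|Eset| ≤ t² + t`, INDEPENDENT of the class size `r` and of the `n_j`):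
a single resonance class contributes no edge direction off the exceptional set of the carrier (no injectivity hypothesis on `n`: a repeated `n_j` makes the
Vandermonde factor, hence the Wronskian, vanish).  HONEST SCOPE (val-idea-crit-8 g5 #94 (W1-d)): «one resonance class» = ALL u-free columns on ONE line
`e + ℕ·q`; this file says NOTHING about two classes or merged resonances (`det(e′ − e ∓ k·s*, p) = 0`) — that clause of the residue sentence of record
(crit-8 #91) stays OPEN.
NEAREST TREE RELATIVES (cited, not restated; crit-8 #94 presearch): ✓ `Literature.LinearAlgebra.Matrix.wronskian_smul` / `wronskian_smul_derivation`
(change of derivation `W_{uD} = u^{C(n,2)} W_D`, a SCALAR multiplier — the lower-triangular pattern reused here with a ray of monomial columns instead) and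
✓ `…BD17ExponentialDescartesSystem.wronskian_exp_const_mul` (real-analytic exponentials `e^{λ_j y}`, Vandermonde in the `λ_j` — the analytic shadow of
`toricW_wronskian_ray` with `ε_q ↦ λ`); neither is the toric statement (derivation `jacDer u`, monomial columns, exact `ε_q`-power).
HONEST LABEL: structural helper toward the OPEN ψ-free residue (TW-count) of the OLM slot of rung 3-AFF (side ladder «table-rank-ladder», crux
`stmt-ValiantsHypothesis-5906` `TwoProducts`); NOT γ; `OLMLaw` / `RankThreeAffineLaw(Exp)` / `TwoProducts` / PCB / `ResidualLawV25` UNMOVED; 0 summit distance;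
VP ≠ VNP is NOT proved.  `--supports stmt-ValiantsHypothesis-5906 --as helper` (val-port-4 g5; critic of record val-idea-crit-8 g5).  Vocabulary by import
(✓ `jac`/`jacDer`/`idet`/`Eset`/`Xc`/`S1`/`wt`/`cross`; ✓ `Literature.LinearAlgebra.Matrix.wronskianMatrix`/`wronskian`); no instances, no notation,
no named facts. [folklore]
-/

noncomputable section
set_option linter.dupNamespace false

namespace Summit.ValiantsHypothesis.ValiantsHypothesis.Theorems.TwoProducts.RankTwoJacobian

open scoped BigOperators Pointwise
open MvPolynomial
open Literature.LinearAlgebra.Matrix (wronskianMatrix wronskian wronskianMatrix_apply wronskian_def)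

section TowerKernel
open scoped Classical

/-! ### §1 The ray polynomial `ε_q` of the carrier -/

/-- `ε_q := Σ_{s ∈ supp u} det(q,s)·u_s·X^s` — the logarithmic toric derivative of the monomial `X^q` along `J(·,u)`: `J(X^q, u) = X^q · ε_q`. -/
def rayEps (u : Poly2) (q : Expo) : Poly2 := ∑ s ∈ u.support, monomial s (coeff s u * ((idet q s : ℤ) : ℂ))

/-- `J(c·X^γ, u) = c·X^γ · ε_γ`. [folklore] -/
theorem toricW_jac_monomial (u : Poly2) (γ : Expo) (c : ℂ) : jac (monomial γ c) u = monomial γ c * rayEps u γ := by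
  rw [jac_eq_sum]
  by_cases hc : c = 0
  · subst hc; simp
  rw [support_monomial, if_neg hc, Finset.sum_singleton]
  unfold rayEps
  rw [Finset.mul_sum]
  refine Finset.sum_congr rfl fun s _ => ?_
  rw [monomial_mul, coeff_monomial, if_pos rfl]
  congr 1; ring

/-- `idet` is additive in its first argument. [folklore] -/
theorem toricW_idet_add (a b s : Expo) : idet (a + b) s = idet a s + idet b s := by
  simp only [idet, Finsupp.add_apply, Nat.cast_add]; ring

/-- `idet (n • q) s = n · idet q s`. [folklore] -/
theorem toricW_idet_nsmul (n : ℕ) (q s : Expo) : idet (n • q) s = (n : ℤ) * idet q s := by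
  simp only [idet, Finsupp.smul_apply, smul_eq_mul, Nat.cast_mul]; ring

/-- `ε_{e + n•q} = ε_e + n·ε_q`. [folklore] -/
theorem rayEps_add_nsmul (u : Poly2) (e q : Expo) (n : ℕ) : rayEps u (e + n • q) = rayEps u e + C (n : ℂ) * rayEps u q := by
  unfold rayEps
  rw [Finset.mul_sum, ← Finset.sum_add_distrib]
  refine Finset.sum_congr rfl fun s _ => ?_
  rw [C_mul_monomial, ← map_add]
  congr 1
  rw [toricW_idet_add, toricW_idet_nsmul]
  push_cast
  ring

/-- the support of `ε_q` lies in the non-constant support `S1 u` of the carrier (`det(q,0) = 0`). [folklore] -/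
theorem support_rayEps_subset (u : Poly2) (q : Expo) : (rayEps u q).support ⊆ S1 u := by
  intro s hs
  unfold rayEps at hs
  obtain ⟨s', hs', hss'⟩ := Finset.mem_biUnion.mp (support_sum hs)
  have h1 := support_monomial_subset hss'
  rw [Finset.mem_singleton] at h1
  subst h1
  rw [MvPolynomial.mem_support_iff, coeff_monomial, if_pos rfl] at hss'
  refine mem_S1.mpr ⟨hs', ?_⟩
  rintro rfl
  apply hss'
  rw [idet_zero_right]; simp

/-! ### §2 Iterating `J(·,u)` on one resonance class: the lower-triangular coefficient table -/

/-- the coefficient table `M a c` of `D^[a](X^{e+nq}) = X^{e+nq} · Σ_c M a c · n^c`:  `M 0 0 = 1`,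
`M (a+1) c = ε_e·M a c + D(M a c) + ε_q·M a (c−1)`. -/
def toricW_coef (u : Poly2) (e q : Expo) : ℕ → ℕ → Poly2
  | 0, c => if c = 0 then 1 else 0
  | a + 1, c => rayEps u e * toricW_coef u e q a c + jac (toricW_coef u e q a c) u +
      (if c = 0 then 0 else rayEps u q * toricW_coef u e q a (c - 1))

/-- `M a c = 0` above the diagonal. [folklore] -/
theorem toricW_coef_eq_zero (u : Poly2) (e q : Expo) : ∀ a c : ℕ, a < c → toricW_coef u e q a c = 0
  | 0, c, h => by
    have hc : c ≠ 0 := by omega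
    simp [toricW_coef, hc]
  | a + 1, c, h => by
    have h1 := toricW_coef_eq_zero u e q a c (by omega)
    have h2 : toricW_coef u e q a (c - 1) = 0 := toricW_coef_eq_zero u e q a (c - 1) (by omega)
    simp only [toricW_coef, h1, h2, mul_zero, zero_add, if_neg (by omega : c ≠ 0)]
    rw [← jacDer_apply, map_zero, zero_add]

/-- the diagonal: `M a a = ε_q^a`. [folklore] -/
theorem toricW_coef_diag (u : Poly2) (e q : Expo) : ∀ a : ℕ, toricW_coef u e q a a = rayEps u q ^ a
  | 0 => by simp [toricW_coef]
  | a + 1 => by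
    have h1 := toricW_coef_eq_zero u e q a (a + 1) (by omega)
    simp only [toricW_coef, h1, mul_zero, if_neg (Nat.succ_ne_zero a), Nat.add_sub_cancel, toricW_coef_diag u e q a]
    rw [← jacDer_apply, map_zero, zero_add, zero_add, pow_succ, mul_comm]

/-- ★ ITERATION FORMULA: `D^[a](X^{e+nq}) = X^{e+nq} · Σ_{c ≤ a} M a c · n^c` for `D = J(·,u)`. -/
theorem toricW_iterate_eq (u : Poly2) (e q : Expo) (n : ℕ) :
    ∀ a : ℕ, (⇑(jacDer u))^[a] (monomial (e + n • q) (1 : ℂ)) =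
      monomial (e + n • q) 1 * ∑ c ∈ Finset.range (a + 1), toricW_coef u e q a c * C ((n : ℂ) ^ c)
  | 0 => by simp [toricW_coef]
  | a + 1 => by
    rw [Function.iterate_succ_apply', toricW_iterate_eq u e q n a, jacDer_apply]
    set f : Poly2 := monomial (e + n • q) 1 with hf
    set S : Poly2 := ∑ c ∈ Finset.range (a + 1), toricW_coef u e q a c * C ((n : ℂ) ^ c) with hS
    -- Leibniz: J(f·S, u) = f·J(S,u) + S·J(f,u), and J(f,u) = f·(ε_e + n ε_q)
    have hjf : jac f u = f * (rayEps u e + C (n : ℂ) * rayEps u q) := by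
      rw [hf, toricW_jac_monomial, rayEps_add_nsmul]
    have hjS : jac S u = ∑ c ∈ Finset.range (a + 1), jac (toricW_coef u e q a c) u * C ((n : ℂ) ^ c) := by
      rw [hS, jac_sum_left]
      refine Finset.sum_congr rfl fun c _ => ?_
      rw [jac_mul_left, jac_C_left, mul_zero, zero_add, mul_comm]
    rw [jac_mul_left, hjf, hjS]
    -- both sides are `f * (…)`; compare the brackets
    have key : (rayEps u e + C (n : ℂ) * rayEps u q) * S + ∑ c ∈ Finset.range (a + 1), jac (toricW_coef u e q a c) u * C ((n : ℂ) ^ c) =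
        ∑ c ∈ Finset.range (a + 2), toricW_coef u e q (a + 1) c * C ((n : ℂ) ^ c) := by
      -- expand the new table
      have hsplit : ∑ c ∈ Finset.range (a + 2), toricW_coef u e q (a + 1) c * C ((n : ℂ) ^ c) =
          ∑ c ∈ Finset.range (a + 2), (rayEps u e * toricW_coef u e q a c + jac (toricW_coef u e q a c) u) * C ((n : ℂ) ^ c) +
          ∑ c ∈ Finset.range (a + 2), (if c = 0 then 0 else rayEps u q * toricW_coef u e q a (c - 1)) * C ((n : ℂ) ^ c) := by
        rw [← Finset.sum_add_distrib]
        refine Finset.sum_congr rfl fun c _ => ?_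
        simp only [toricW_coef]; ring
      rw [hsplit]
      -- first sum: the `c = a+1` term vanishes (above the diagonal)
      have hA : ∑ c ∈ Finset.range (a + 2), (rayEps u e * toricW_coef u e q a c + jac (toricW_coef u e q a c) u) * C ((n : ℂ) ^ c) =
          ∑ c ∈ Finset.range (a + 1), (rayEps u e * toricW_coef u e q a c + jac (toricW_coef u e q a c) u) * C ((n : ℂ) ^ c) := by
        rw [Finset.sum_range_succ, toricW_coef_eq_zero u e q a (a + 1) (by omega), mul_zero, ← jacDer_apply, map_zero, zero_add,
          zero_mul, add_zero]
      -- second sum: shift the index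
      have hB : ∑ c ∈ Finset.range (a + 2), (if c = 0 then 0 else rayEps u q * toricW_coef u e q a (c - 1)) * C ((n : ℂ) ^ c) =
          ∑ c ∈ Finset.range (a + 1), rayEps u q * toricW_coef u e q a c * C ((n : ℂ) ^ (c + 1)) := by
        rw [Finset.sum_range_succ']
        simp only [Nat.succ_ne_zero, ite_false, ite_true, zero_mul, add_zero, Nat.add_sub_cancel]
      rw [hA, hB, hS, Finset.mul_sum, ← Finset.sum_add_distrib, ← Finset.sum_add_distrib]
      refine Finset.sum_congr rfl fun c _ => ?_
      rw [pow_succ, map_mul]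
      ring
    rw [← key]
    ring

/-! ### §3 The factorisation of the Wronskian matrix and the exact formula -/

/-- the lower-triangular table as a matrix. -/
def toricW_M (u : Poly2) (e q : Expo) (r : ℕ) : Matrix (Fin r) (Fin r) Poly2 :=
  Matrix.of fun a c => toricW_coef u e q a c

/-- the «Vandermondeᵀ · diagonal» factor: `N c j = n_j^c · X^{e + n_j q}`. -/
def toricW_N (e q : Expo) {r : ℕ} (n : Fin r → ℕ) : Matrix (Fin r) (Fin r) Poly2 :=
  Matrix.of fun c j => C (((n j : ℕ) : ℂ) ^ (c : ℕ)) * monomial (e + n j • q) (1 : ℂ)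

/-- ★ FACTORISATION: `wronskianMatrix (J(·,u)) (X^{e+n_j q})_j = M · N`. -/
theorem toricW_wronskianMatrix_eq (u : Poly2) (e q : Expo) {r : ℕ} (n : Fin r → ℕ) :
    wronskianMatrix (⇑(jacDer u)) (fun j : Fin r => monomial (e + n j • q) (1 : ℂ)) = toricW_M u e q r * toricW_N e q n := by
  refine Matrix.ext fun a j => ?_
  rw [wronskianMatrix_apply, toricW_iterate_eq, Matrix.mul_apply]
  unfold toricW_M toricW_N
  simp only [Matrix.of_apply]
  -- extend the range sum to all of `Fin r` (entries above the diagonal vanish)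
  have har : (a : ℕ) < r := a.isLt
  have hsub : Finset.range ((a : ℕ) + 1) ⊆ Finset.range r := Finset.range_subset_range.mpr (by omega)
  have hext : ∑ c ∈ Finset.range ((a : ℕ) + 1), toricW_coef u e q a c * C (((n j : ℕ) : ℂ) ^ c) =
      ∑ c : Fin r, toricW_coef u e q a c * C (((n j : ℕ) : ℂ) ^ (c : ℕ)) := by
    rw [← Finset.sum_range (fun c => toricW_coef u e q a c * C (((n j : ℕ) : ℂ) ^ c))]
    refine Finset.sum_subset hsub fun c hc hnc => ?_
    have h2 : ¬ c < (a : ℕ) + 1 := fun h => hnc (Finset.mem_range.mpr h)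
    rw [toricW_coef_eq_zero u e q a c (by omega), zero_mul]
  rw [hext, Finset.mul_sum]
  refine Finset.sum_congr rfl fun c _ => ?_
  ring

/-- `det M = ε_q^{C(r,2)}`. [folklore] -/
theorem toricW_det_M (u : Poly2) (e q : Expo) (r : ℕ) : (toricW_M u e q r).det = rayEps u q ^ (r.choose 2) := by
  rw [Matrix.det_of_lowerTriangular]
  · unfold toricW_M
    simp only [Matrix.of_apply, toricW_coef_diag]
    rw [Finset.prod_pow_eq_pow_sum, Fin.sum_univ_eq_sum_range (fun i => i) r, Finset.sum_range_id, Nat.choose_two_right]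
  · intro i j hij
    exact toricW_coef_eq_zero u e q i j (Fin.lt_def.1 (OrderDual.toDual_lt_toDual.1 hij))

/-- `det N = Π_{i<j}(n_j − n_i) · X^{Σ (e + n_j q)}`. [folklore] -/
theorem toricW_det_N (e q : Expo) {r : ℕ} (n : Fin r → ℕ) :
    (toricW_N e q n).det = C (∏ i : Fin r, ∏ j ∈ Finset.Ioi i, (((n j : ℕ) : ℂ) - n i)) * monomial (∑ j, (e + n j • q)) (1 : ℂ) := by
  have hN : toricW_N e q n =
      ((Matrix.vandermonde (fun j : Fin r => ((n j : ℕ) : ℂ))).transpose.map (C : ℂ →+* Poly2)) *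
        Matrix.diagonal (fun j : Fin r => monomial (e + n j • q) (1 : ℂ)) := by
    ext c j
    unfold toricW_N
    rw [Matrix.mul_diagonal, Matrix.map_apply, Matrix.transpose_apply, Matrix.vandermonde_apply, Matrix.of_apply]
  have hdet : ((Matrix.vandermonde (fun j : Fin r => ((n j : ℕ) : ℂ))).transpose.map (C : ℂ →+* Poly2)).det =
      C (∏ i : Fin r, ∏ j ∈ Finset.Ioi i, (((n j : ℕ) : ℂ) - n i)) := by
    rw [← RingHom.mapMatrix_apply, ← RingHom.map_det, Matrix.det_transpose, Matrix.det_vandermonde]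
  rw [hN, Matrix.det_mul, Matrix.det_diagonal, hdet, ← monomial_sum_one]

/-- ★★ **THE EXACT FORMULA FOR ONE RESONANCE CLASS:**
`W_{J(·,u)}(X^{e+n_1 q},…,X^{e+n_r q}) = ε_q^{C(r,2)} · Π_{i<j}(n_j − n_i) · X^{Σ_j (e+n_j q)}` for ALL `u, e, q, n`. -/
theorem toricW_wronskian_ray (u : Poly2) (e q : Expo) {r : ℕ} (n : Fin r → ℕ) :
    wronskian (⇑(jacDer u)) (fun j : Fin r => monomial (e + n j • q) (1 : ℂ)) =
      rayEps u q ^ (r.choose 2) * C (∏ i : Fin r, ∏ j ∈ Finset.Ioi i, (((n j : ℕ) : ℂ) - n i)) *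
        monomial (∑ j, (e + n j • q)) (1 : ℂ) := by
  rw [wronskian_def, toricW_wronskianMatrix_eq, Matrix.det_mul, toricW_det_M, toricW_det_N, mul_assoc]

/-! ### §4 Consequence: a single class has no edge direction off `Xc σ u` -/

/-- a polynomial supported inside `S1 u` has its edge directions in `Xc σ u` (a tie between two points of `S1 u` is a crossing value). [folklore] -/
theorem toricW_Eset_subset_Xc_of_support {σ : ℝ} (hσ : σ = 1 ∨ σ = -1) {u G : Poly2} (hG : G.support ⊆ S1 u) :
    Eset σ G ⊆ Xc σ u := by
  intro μ hμ
  obtain ⟨a, ha, b, hb, hab, -, hwt⟩ := (mem_Eset hσ).mp hμ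
  have ha' := hG ha
  have hb' := hG hb
  by_cases h0 : a 0 = b 0
  · exact absurd (eq_of_wt_eq hσ h0 hwt.symm) hab
  · unfold Xc
    apply Finset.mem_union_left
    rw [Finset.mem_image]
    refine ⟨(a, b), Finset.mem_filter.mpr ⟨Finset.mem_product.mpr ⟨ha', hb'⟩, h0⟩, ?_⟩
    exact (wt_eq_imp_cross h0 hwt.symm).symm

/-- a monomial has no edge direction. [folklore] -/
theorem toricW_Eset_monomial (σ : ℝ) (γ : Expo) (c : ℂ) : Eset σ (monomial γ c : Poly2) = ∅ := by
  refine Finset.eq_empty_of_forall_notMem fun μ hμ => ?_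
  have h := (Finset.mem_filter.mp hμ).2
  obtain ⟨a, ha, b, hb, hab, -, -⟩ := h
  have ha' := support_monomial_subset ha
  have hb' := support_monomial_subset hb
  rw [Finset.mem_singleton] at ha' hb'
  exact hab (ha'.trans hb'.symm)

/-- ★ **ONE RESONANCE CLASS IS TAME:** for pairwise distinct `n_j`, the edge directions of `W_{J(·,u)}(X^{e+n_j q})_j` in the chart `σ` lie in
`Xc σ u` — so there are `≤ t² + t` of them (✓ `card_Xc_le`), independently of the class size `r` and of the `n_j`. -/
theorem toricW_Eset_ray_subset {σ : ℝ} (hσ : σ = 1 ∨ σ = -1) (u : Poly2) (e q : Expo) {r : ℕ} (n : Fin r → ℕ) :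
    Eset σ (wronskian (⇑(jacDer u)) (fun j : Fin r => monomial (e + n j • q) (1 : ℂ))) ⊆ Xc σ u := by
  rw [toricW_wronskian_ray]
  set A := rayEps u q ^ (r.choose 2) with hA
  set B := C (∏ i : Fin r, ∏ j ∈ Finset.Ioi i, (((n j : ℕ) : ℂ) - n i)) * monomial (∑ j, (e + n j • q)) (1 : ℂ) with hB
  have hBmono : B = monomial (∑ j, (e + n j • q)) (∏ i : Fin r, ∏ j ∈ Finset.Ioi i, (((n j : ℕ) : ℂ) - n i)) := by
    rw [hB, C_mul_monomial, mul_one]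
  rw [mul_assoc, ← hB]
  by_cases hA0 : A = 0
  · rw [hA0, zero_mul, Eset_zero]; exact Finset.empty_subset _
  by_cases hB0 : B = 0
  · rw [hB0, mul_zero, Eset_zero]; exact Finset.empty_subset _
  intro μ hμ
  have hedge := (mem_Eset hσ).mp hμ
  rcases (ostrowski _ A B hA0 hB0).mp hedge with h | h
  · have hmem : μ ∈ Eset σ A := (mem_Eset hσ).mpr h
    have hsub : Eset σ A ⊆ Eset σ (rayEps u q) := by rw [hA]; exact Eset_pow_subset hσ (rayEps u q) _
    exact toricW_Eset_subset_Xc_of_support hσ (support_rayEps_subset u q) (hsub hmem)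
  · have hmem : μ ∈ Eset σ B := (mem_Eset hσ).mpr h
    rw [hBmono, toricW_Eset_monomial] at hmem
    exact absurd hmem (Finset.notMem_empty _)

/-- ★ COUNT: `|Eset σ W| ≤ t² + t` for a `t`-sparse carrier, any class size. [folklore] -/
theorem toricW_card_Eset_ray_le {σ : ℝ} (hσ : σ = 1 ∨ σ = -1) {t : ℕ} (u : Poly2) (hu : u.support.card ≤ t) (e q : Expo) {r : ℕ}
    (n : Fin r → ℕ) :
    (Eset σ (wronskian (⇑(jacDer u)) (fun j : Fin r => monomial (e + n j • q) (1 : ℂ)))).card ≤ t * t + t :=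
  (Finset.card_le_card (toricW_Eset_ray_subset hσ u e q n)).trans
    ((card_Xc_le σ u).trans (Nat.add_le_add (Nat.mul_le_mul hu hu) hu))

end TowerKernel

end Summit.ValiantsHypothesis.ValiantsHypothesis.Theorems.TwoProducts.RankTwoJacobian

end
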